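import Summits.ResolutionOfSingularities.ResolutionOfSingularities.Theorems.MarkedTransferCampaignW46ThreefoldsGammaFreeGlobalMonomial
import Summits.ResolutionOfSingularities.ResolutionOfSingularities.Theorems.MarkedTransferCampaignW46ThreefoldsHostMonomial
import Literature.AlgebraicGeometry.Resolution.BlowupChartMembership
import HarnessLib

/-!
# [OURS · L1 W4.6 rung (ii-M)] THE ORDER-ONE SLICE — every hypersurface input of maximal order `≤ 1` (a REGULAR
# hypersurface) is settled, for every exponent `m`, in every dimension: Γ-free (`OrderReducible`) and host shape
# (`IsMarkedResolution` with empty / own boundary), PROVED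

Cell res-hironaka, LADDER-RESOLUTION rung L (D-0089), slot W4.6, rung (ii) (threefold hypersurfaces); seat res-L1-s46-pv-3
(gen 3). Host route MarkedTransfer, host item `HypersurfaceOrderReductionDimLeThree` (stmt-ResolutionOfSingularities-16156);
filed `--kind proof --supports` it `--as helper`. Everything here is OURS: kernel theorems over the campaign definitions
and PROVED tree lemmas; NOTHING is a statement of Hironaka's manuscript; no typed `Hironaka2017` candidate enters; no named
FACT is a hypothesis. AI-written; AI review is weaker than expert review.

## What is proved (no new definitions)

On a regular locally Noetherian scheme `X`, an effective Cartier ideal `I` with `ord_x I ≤ 1` at every point is, at each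
point of its support, generated by ONE element of order ONE — `V(I)` is a regular hypersurface — so `[I]` is a
simple-normal-crossings boundary (`hasSNC_singleton_of_idealOrder_le_one`, via the tree's `hasSNC_singleton_of_generator`)
and the divisorial slice (`…GammaFreeGlobalMonomial.lean` p499147, `…HostMonomial.lean` p499991) applies:

* `CampaignW46.orderReducible_pow_of_idealOrder_le_one` / `…_of_idealOrder_le_one` — `OrderReducible (I ^ a) m` and
  `OrderReducible I m` for every `a` and every `m ≥ 1`;
* `CampaignW46.exists_isMarkedResolution_pow_nil_of_idealOrder_le_one` / `…_pow_self_…` — the host shape: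
  BGMW marked resolutions of `(X, I^a, ∅, m)` and `(X, I^a, [I], m)`;
* `CampaignW46.gammaFreeGlobalDimLE_orderOne_slice (p d)` — the ladder's binders (`GammaFreeGlobalOrderReductionDimLE p d`,
  p496755) plus ONE hypothesis `∀ x, ord_x I ≤ 1` ⇒ `∀ a, ∀ m ≥ 1, OrderReducible (I ^ a) m` (every `d`, incl. `d = 3`);
* `CampaignW46.hostItem_orderOne_slice_nil` — stmt-16156's binders with EMPTY boundary plus `∀ x, ord_x I ≤ 1` ⇒ for
  every `a`, `m ≥ 1` a marked resolution of `(X, I^a, ∅, m)` (the given-boundary case needs `V(I)` to cross `E` normally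
  and is NOT claimed).

HONEST VALUE. Small and classical: the regime-(ii) inputs whose hypersurface is already regular (with any multiplicity
`a` and any exponent `m`: e.g. `((x₂)^a, m)`, the double plane of p490164) are order-reducible / resolved in the host's
sense by blowing up the hypersurface itself (identity blow-ups dividing by `I^m`). It is the `r = 1` corner of the
monomial slice, stated from the ORDER hypothesis a reader of the rung statement has in hand. Nothing about inputs of
order `≥ 2`.

References: `…ThreefoldsGammaFreeGlobalMonomial.lean` (p499147), `…ThreefoldsHostMonomial.lean` (p499991),
`…ThreefoldsGammaFreeGlobalLadder.lean` (p496755); tree `Resolution/BlowupChartMembership.lean`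
(`IsEffectiveCartier.exists_stalkIdeal_eq_span`), `Resolution/KollarMaxContactPersistence.lean`
(`hasSNC_singleton_of_generator` [Matsumura1987, Thm. 14.2]), `Resolution/MarkedIdeals.lean` (`le_idealOrder_iff`
[BierstoneGrigorievMilmanWlodarczyk2011, §3.1]). H. Hironaka, ms. 2017-03-23 — scope only, under adjudication, not
cited as fact. [Hironaka2017]
-/

noncomputable section

set_option linter.dupNamespace false -- mandated namespace of this single-conjunct summit

open CategoryTheory AlgebraicGeometry TopologicalSpace IsLocalRing

namespace Summit.ResolutionOfSingularities.ResolutionOfSingularities.Theorems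

namespace CampaignW46

open Literature.AlgebraicGeometry.Resolution
open Scheme.IdealSheafData

universe u

variable {X : Scheme.{u}}

/-! ## §1 Order `≤ 1` everywhere: a regular hypersurface is a simple-normal-crossings divisor -/

/-- **An effective Cartier ideal of order `≤ 1` at every point of a regular locally Noetherian scheme is a
simple-normal-crossings divisor `[I]`**: at a point `x` of its support `I_x = (t)` (Cartier) and `ord_x I = 1`, so
`t ∉ 𝔪_x²` — `V(I)` is a regular hypersurface — and the tree's `hasSNC_singleton_of_generator` applies.
[cite: Matsumura1987, Thm. 14.2] -/
theorem hasSNC_singleton_of_idealOrder_le_one [IsLocallyNoetherian X] (hX : Scheme.IsRegular X)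
    {I : X.IdealSheafData} (hI : IsEffectiveCartier I) (h1 : ∀ x : X, idealOrder I x ≤ 1) : HasSNC [I] := by
  refine hasSNC_singleton_of_generator hX fun x _ => ?_
  obtain ⟨t, -, ht⟩ := hI.exists_stalkIdeal_eq_span x
  refine ⟨t, ht, fun ht2 => ?_⟩
  have h2 : ((2 : ℕ) : ℕ∞) ≤ idealOrder I x := by
    rw [le_idealOrder_iff, ht, Ideal.span_singleton_le_iff_mem]
    exact ht2
  have h3 : ((2 : ℕ) : ℕ∞) ≤ 1 := h2.trans (h1 x)
  exact absurd h3 (by decide)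

/-! ## §2 Γ-free: order-reducibility -/

/-- **THE ORDER-ONE SLICE, Γ-free form, powers**: on a regular locally Noetherian `X`, an effective Cartier `I` with
`ord_x I ≤ 1` everywhere has every power order-reducible: `OrderReducible (I ^ a) m`, `m ≥ 1`.
[cite: Kollar2007, (3.111) Step 3] -/
theorem orderReducible_pow_of_idealOrder_le_one [IsLocallyNoetherian X] (hX : Scheme.IsRegular X)
    {I : X.IdealSheafData} (hI : IsEffectiveCartier I) (h1 : ∀ x : X, idealOrder I x ≤ 1) (a : ℕ) {m : ℕ}
    (hm : 1 ≤ m) : OrderReducible (I ^ a) m :=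
  orderReducible_pow_of_hasSNC_singleton (hasSNC_singleton_of_idealOrder_le_one hX hI h1) a hm

/-- **THE ORDER-ONE SLICE, Γ-free form**: `OrderReducible I m` for every `m ≥ 1` when `ord_x I ≤ 1` everywhere (for
`m ≥ 2` the empty sequence; for `m = 1` one identity blow-up of the regular hypersurface `V(I)`).
[cite: Kollar2007, (3.111) Step 3] -/
theorem orderReducible_of_idealOrder_le_one [IsLocallyNoetherian X] (hX : Scheme.IsRegular X)
    {I : X.IdealSheafData} (hI : IsEffectiveCartier I) (h1 : ∀ x : X, idealOrder I x ≤ 1) {m : ℕ} (hm : 1 ≤ m) :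
    OrderReducible I m := by
  simpa using orderReducible_pow_of_idealOrder_le_one hX hI h1 1 hm

/-! ## §3 Host shape: marked resolutions with empty / own boundary -/

/-- **THE ORDER-ONE SLICE, host shape, empty boundary**: a BGMW marked resolution of `(X, I^a, ∅, m)`, `m ≥ 1`, for an
effective Cartier `I` of order `≤ 1` everywhere on a regular locally Noetherian `X`. [cite: Kollar2007, (3.111) Step 3] -/
theorem exists_isMarkedResolution_pow_nil_of_idealOrder_le_one [IsLocallyNoetherian X] (hX : Scheme.IsRegular X)
    {I : X.IdealSheafData} (hI : IsEffectiveCartier I) (h1 : ∀ x : X, idealOrder I x ≤ 1) (a : ℕ) {m : ℕ}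
    (hm : 1 ≤ m) :
    ∃ (X' : Scheme.{u}) (Φ : X' ⟶ X) (M' : MarkedIdeal X'), IsMarkedResolution (⟨I ^ a, [], m⟩ : MarkedIdeal X) Φ M' :=
  exists_isMarkedResolution_pow_of_hasSNC_singleton_nil (hasSNC_singleton_of_idealOrder_le_one hX hI h1) a hm

/-- **THE ORDER-ONE SLICE, host shape, own boundary `[I]`**: a BGMW marked resolution of `(X, I^a, [I], m)`, `m ≥ 1`.
[cite: Kollar2007, (3.111) Step 3] -/
theorem exists_isMarkedResolution_pow_self_of_idealOrder_le_one [IsLocallyNoetherian X] (hX : Scheme.IsRegular X)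
    {I : X.IdealSheafData} (hI : IsEffectiveCartier I) (h1 : ∀ x : X, idealOrder I x ≤ 1) (a : ℕ) {m : ℕ}
    (hm : 1 ≤ m) :
    ∃ (X' : Scheme.{u}) (Φ : X' ⟶ X) (M' : MarkedIdeal X'), IsMarkedResolution (⟨I ^ a, [I], m⟩ : MarkedIdeal X) Φ M' :=
  exists_isMarkedResolution_pow_of_hasSNC_singleton (hasSNC_singleton_of_idealOrder_le_one hX hI h1) a hm

/-! ## §4 In the ladder's and the host item's binders -/

/-- **THE ORDER-ONE SLICE OF EVERY RUNG OF THE Γ-FREE LADDER** (`GammaFreeGlobalOrderReductionDimLE p d`, p496755):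
its binders plus `∀ x, ord_x I ≤ 1` give `OrderReducible (I ^ a) m` for every power `a` and every `m ≥ 1` — at every
`d`, in particular `d = 3`. Only local Noetherianity, regularity and the Cartier hypothesis are used.
[cite: Kollar2007, (3.111) Step 3] -/
theorem gammaFreeGlobalDimLE_orderOne_slice (p d : ℕ) :
    p.Prime → ∀ (k : Type u) [Field k] [CharP k p] [PerfectField k] (X : Scheme.{u}) (s : X ⟶ Spec (.of k)),
      IsSeparated s → LocallyOfFiniteType s → QuasiCompact s → IsIntegral X → Scheme.IsRegular X →
        topologicalKrullDim X ≤ d → ∀ (I : X.IdealSheafData), I ≠ ⊥ → IsEffectiveCartier I →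
          (∀ x : X, idealOrder I x ≤ 1) → ∀ (a m : ℕ), 1 ≤ m → OrderReducible (I ^ a) m := by
  intro _ k _ _ _ X s _ hloft _ _ hreg _ I _ hIc h1 a m hm
  haveI : IsLocallyNoetherian X := LocallyOfFiniteType.isLocallyNoetherian s
  exact orderReducible_pow_of_idealOrder_le_one hreg hIc h1 a hm

/-- **THE ORDER-ONE SLICE OF THE HOST ITEM stmt-16156 WITH EMPTY BOUNDARY**: its binders (universe-polymorphic, `E = []`)
plus `∀ x, ord_x I ≤ 1` give, for every power `a` and every `m ≥ 1`, a BGMW marked resolution of `(X, I^a, ∅, m)`. The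
case of a non-empty given boundary `E` needs `V(I)` to have simple normal crossings with `E` and is not claimed here.
[cite: Kollar2007, (3.111) Step 3] -/
theorem hostItem_orderOne_slice_nil :
    ∀ p : ℕ, p.Prime → ∀ (k : Type u) [Field k] [CharP k p] [PerfectField k] (X : Scheme.{u}) (s : X ⟶ Spec (.of k)),
      IsSeparated s → LocallyOfFiniteType s → QuasiCompact s → IsIntegral X → Scheme.IsRegular X →
        topologicalKrullDim X ≤ 3 → ∀ (I : X.IdealSheafData), I ≠ ⊥ → IsEffectiveCartier I →
          (∀ x : X, idealOrder I x ≤ 1) → ∀ (a m : ℕ), 1 ≤ m →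
            ∃ (X' : Scheme.{u}) (Φ : X' ⟶ X) (M' : MarkedIdeal X'),
              IsMarkedResolution (⟨I ^ a, [], m⟩ : MarkedIdeal X) Φ M' := by
  intro _ _ k _ _ _ X s _ hloft _ _ hreg _ I _ hIc h1 a m hm
  haveI : IsLocallyNoetherian X := LocallyOfFiniteType.isLocallyNoetherian s
  exact exists_isMarkedResolution_pow_nil_of_idealOrder_le_one hreg hIc h1 a hm

end CampaignW46

end Summit.ResolutionOfSingularities.ResolutionOfSingularities.Theorems

end
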